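import Summits.BirchSwinnertonDyer.Rank1Residual.X11b.Three.ZhangAtThreeNonsplit
import HarnessLib

/-!
# TYPED OBJECT Z₃-tam (cell `bsd-stepL`, seat `bsd-stepL-koly` g6; memo `koly/MEMO-v6.md`) — the K0⋆ form
# of STEP L on the TAMAGAWA cells at `3 ∥ N`: a level-`(t+1)` Kolyvagin certificate, `t = ord₃ ∏_ℓ c_ℓ(E/ℚ)`,
# i.e. McCallum's `M_∞ ≤ t` — WITHOUT the hypothesis `3 ∤ ∏ c_ℓ`

Typed object of record-to-be for the (T2′)@3 Tamagawa cells (planner ruling (R-af), TARGET v1.29: «P3 YES», filed by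
koly g9 as a NEW module next to `ZhangAtThreeNonsplit.lean` rather than an append, to keep that file under the length cap).
HONEST FRAMING: `ZhangAtThreeTamagawa` is a hypothesis-shaped `Prop`; NOTHING asserts it; `@[conjecture]`. MEMO-v6 does NOT prove it: the memo is a BLUEPRINT with a brick table
(CONSTRUCTION grade) plus the negative lemma «the mod-3 road returns zero on a Tamagawa cell». The theorems
below say only: (1) on the atom A1 (`3 ∤ ∏ c_ℓ`, so `t = 0`) Z₃-tam is implied by the refereed umbrella
`ZhangAtThreeSharp` (bookkeeping: a non-zero `c_1(n)` is a level-`1` certificate); (2) IF Z₃-tam holds then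
STEP L (`X11b.IndexLowerBoundAt W 3 K y_K`) follows from the McCallum fact by the tree's kernel
`Koly.indexLowerBoundAt_of_certificateAt_of_mccallum`, which takes a certificate of ANY level `M + 1` with
`M ≤ ord₃ ∏ c_ℓ` — here `M = t` exactly, so NO Tamagawa hypothesis remains.

Why the conclusion is a level-`(t+1)` certificate and not a non-zero `c_1(n)`: on a Tamagawa cell
(`t ≥ 1`), granted the BSD formula for `E/K` and McCallum's `ord₃ #Ш(E/K) = 2(M₀ − M_∞)`, one has
`M_∞ = t ≥ 1`, so EVERY mod-3 class `c_1(n)` vanishes (`P_n ∈ 3E(K[n])` for all `n`; in particular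
`y_K ∈ 3E(K)`); W. Zhang's refined conjecture (CDM survey, Conj. 4.4) is `M_∞ = t`. The statement below is
its STEP-L half `M_∞ ≤ t` (the other half, `M_∞ ≥ t`, is the Jetchev-direction upper bound on `Ш`).
In print at GOOD ordinary `p > 3`: Castella–Sano arXiv:2601.14504 Thm 3 (refined Kolyvagin ⟺ the
anticyclotomic main conjecture, determinant form); Burungale–Castella–Grossi–Skinner arXiv:2312.09301
(`p` split, via BDP). Nothing at `p ∣ N`, nothing at `p = 3`.
-/

noncomputable section

open scoped Classical

namespace Summit.BirchSwinnertonDyer.Rank1Residual.X11b.Three.Koly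

open WeierstrassCurve Literature.NumberTheory.EllipticCurves
  Literature.NumberTheory.EllipticCurves.ModularForms

/-- **Typed object Z₃-tam (NOT asserted; NOT proved in the memo — blueprint grade; no census word).**
For `E/ℚ` globally minimal with multiplicative reduction at `3 ∥ N`, `ρ̄_{E,3}` onto, Ram (`∃ ℓ₀ ≠ 3`
multiplicative with `3 ∤ v_{ℓ₀}(Δ_min)`), `K` imaginary quadratic Heegner for `N_E` with `d_K ≠ −3` — and
NO hypothesis on `∏ c_ℓ` —: some modular parametrisation datum carries a Kolyvagin certificate of level
`t + 1`, `t = ord₃ ∏_ℓ c_ℓ(E/ℚ)` (`Koly.CertificateAt Dt β ι 3 t`: an `n ∈ S_r(t+1)` with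
`P_n ∉ 3^{t+1} E(K[n])`), i.e. McCallum's `M_∞ ≤ t` (`Koly.minf_le_of_certificateAt`). On A1 (`t = 0`) this is
Kolyvagin's conjecture in W. Zhang's form and follows from `ZhangAtThreeSharp`
(`zhangAtThreeTamagawa_of_zhangAtThreeSharp_of_not_dvd`); on the (T2′) cells (`t ≥ 1`) it is the STEP-L
half of W. Zhang's refined Kolyvagin conjecture `M_∞ = t`. Hypothesis-shaped `Prop`; cell bsd-stepL, seat
koly, memo `koly/MEMO-v6.md` (blueprint + negative lemma, NOT a proof).
[cite: McCallumLMS1991, §5 (p. 303) definition of M_r and Cor. 5.6 (p. 310) — shape of the certificate]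
[cite: WZhang2014, Thm. 1.1 (p. 195) — shape only (the t = 0 case at good p ≥ 5); nothing asserted] -/
@[conjecture] def ZhangAtThreeTamagawa (W : WeierstrassCurve ℚ) [W.IsElliptic] [W.IsGloballyMinimal]
    [NeZero (W.conductorNorm ℤ)] (K : Type) [Field K] [NumberField K] : Prop :=
  W.HasMultiplicativeReductionAtPrime 3 →
  W.HasSurjectiveModNGaloisRep 3 →
  (∃ (ℓ : ℕ) (_ : Fact ℓ.Prime), ℓ ≠ 3 ∧ W.HasMultiplicativeReductionAtPrime ℓ ∧
      ¬ 3 ∣ padicValInt ℓ W.minimalDiscriminantInt) →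
  IsImaginaryQuadratic K → SatisfiesHeegnerHypothesis (W.conductorNorm ℤ) K →
  NumberField.discr K ≠ -3 →
  ∃ (Dt : ModularParametrizationData W (W.conductorNorm ℤ)) (β : ℤ) (ι : K →+* ℂ),
    CertificateAt Dt β ι 3 (padicValNat 3 W.tamagawaProduct)

/-- **On A1, Z₃♯ gives Z₃-tam** (bookkeeping): if `3 ∤ ∏ c_ℓ` then `t = ord₃ ∏ c_ℓ = 0`, and a non-zero
`c_1(n)` with `n ∈ Λ` (the conclusion of `ZhangAtThreeSharp`) is a level-`1` certificate
(`certificateAt_zero_of_kolyvaginClass_one_ne_zero`). Nothing is asserted about either statement.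
[cite: McCallumLMS1991, Cor. 4.5 (c_M(n) = 0 iff P_n ∈ p^M E(K_n))] -/
theorem zhangAtThreeTamagawa_of_zhangAtThreeSharp_of_not_dvd (W : WeierstrassCurve ℚ) [W.IsElliptic]
    [W.IsGloballyMinimal] [NeZero (W.conductorNorm ℤ)] (K : Type) [Field K] [NumberField K]
    (htam : ¬ 3 ∣ W.tamagawaProduct) (h : ZhangAtThreeSharp W K) :
    ZhangAtThreeTamagawa W K := by
  intro hmult hρ hram hK hH h3
  obtain ⟨Dt, β, ι, n, d, hn, hne⟩ := h hmult hρ hram htam hK hH h3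
  refine ⟨Dt, β, ι, ?_⟩
  rw [padicValNat.eq_zero_of_not_dvd htam]
  exact certificateAt_zero_of_kolyvaginClass_one_ne_zero d hn hne

/-- **Z₃-tam ⇒ STEP L at 3 on A1 ∪ (T2′)** — the K0⋆ form: a level-`(t+1)` certificate with
`t = ord₃ ∏ c_ℓ` feeds the tree's kernel `Koly.indexLowerBoundAt_of_certificateAt_of_mccallum` with
`M = t ≤ t`; NO Tamagawa hypothesis. Tower surjectivity at a multiplicative 3 is the tree theorem
`Rank1Residual.surjective_pow_three_of_mult_of_tateLine` (Wuthrich 2014, Lemma 20). CONDITIONAL on the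
McCallum fact `hMc`; `hZ : ZhangAtThreeTamagawa W K` is a HYPOTHESIS (open; blueprint grade).
[cite: McCallumLMS1991, §5 Cor. 5.6 (p. 310)] [cite: Wuthrich2014, Lemma 20 (p. 399)] -/
theorem exists_indexLowerBoundAt_three_of_zhangAtThreeTamagawa_of_mccallum
    (W : WeierstrassCurve ℚ) [W.IsElliptic] [W.IsGloballyMinimal] [NeZero (W.conductorNorm ℤ)]
    (K : Type) [Field K] [NumberField K]
    (hZ : ZhangAtThreeTamagawa W K) (hMc : McCallum1991_pow_dvd_card_sha_primary_of_certificate)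
    (hmult : W.HasMultiplicativeReductionAtPrime 3)
    (hρ : W.HasSurjectiveModNGaloisRep 3)
    (hram : ∃ (ℓ : ℕ) (_ : Fact ℓ.Prime), ℓ ≠ 3 ∧ W.HasMultiplicativeReductionAtPrime ℓ ∧
      ¬ 3 ∣ padicValInt ℓ W.minimalDiscriminantInt)
    (hK : IsImaginaryQuadratic K) (hH : SatisfiesHeegnerHypothesis (W.conductorNorm ℤ) K)
    (h3 : NumberField.discr K ≠ -3) (h4 : NumberField.discr K ≠ -4) (hCM : ¬ W.HasCM)
    (hrank : (W.baseChange K).mordellWeilRank = 1)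
    (hiv : ∀ x : (W.baseChange K).toAffine.Point, 3 • x = 0 → x = 0)
    [Finite (W.baseChange K).sha] :
    ∃ (Dt : ModularParametrizationData W (W.conductorNorm ℤ)) (β : ℤ) (ι : K →+* ℂ),
      ∀ (d₁ : KolyvaginHeegnerData Dt β ι 1) (P : (W.baseChange K).toAffine.Point),
        d₁.toGeomPoints d₁.derivedPoint = toGeomPoints (W.baseChange K) P →
        ¬ IsOfFinAddOrder P →
        ∀ (M₀ : ℕ), (∃ Q : (W.baseChange K).toAffine.Point, ((3 ^ M₀ : ℕ) : ℤ) • Q = P) →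
          (¬ ∃ Q : (W.baseChange K).toAffine.Point, ((3 ^ (M₀ + 1) : ℕ) : ℤ) • Q = P) →
          IndexLowerBoundAt W 3 K P := by
  -- tower surjectivity at 3 is a THEOREM at a multiplicative 3 (Wuthrich 2014, Lemma 20; tree)
  have hsurj : ∀ m : ℕ, W.HasSurjectiveModNGaloisRep (3 ^ m : ℕ) :=
    Rank1Residual.surjective_pow_three_of_mult_of_tateLine W hmult hρ
  obtain ⟨Dt, β, ι, hcert⟩ := hZ hmult hρ hram hK hH h3
  exact ⟨Dt, β, ι, fun d₁ P hP hPinf M₀ hdiv hndiv ↦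
    indexLowerBoundAt_of_certificateAt_of_mccallum W K hMc hCM hK h3 h4 hH 3 (by norm_num)
      hsurj Dt β ι d₁ P hP hPinf hrank hiv hdiv hndiv hcert le_rfl⟩

end Summit.BirchSwinnertonDyer.Rank1Residual.X11b.Three.Koly

end
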